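import Literature.IUT.LogThetaLattice.PacketLogVolumesHaarModelCapsulesGeneral
import Literature.IUT.LogVolume.TensorPacketFactorIso
import Literature.IUT.LogVolume.ArchimedeanPacketLogVolumeInvariance
import HarnessLib

/-!
# [IUTchIII] Proposition 3.9 (ii) for CAPSULES at the genuine model: `μ^log_{A,v_ℚ}` and `μ^log_{A,𝕍_ℚ}` are
# invariant under the factorwise isometric automorphisms of the portions `⊗_α F_{v_α}` / `⊗_{α,ℝ}ℂ` — the
# mono-analytic compatibility / `Ism`-indeterminacy at the `A`-packets, BY NAME (abc-iut cell, layer L6, row «CAP39»)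

S. Mochizuki, *Inter-universal Teichmüller theory III*, kurims manuscript (May 2020), Proposition 3.9 (ii)
"(Mono-analytic Compatibility)", p. 116 [claim: Mochizuki2012, status: disputed]: "… by applying the
`p_{v_ℚ}`-adic log-volume, when `v_ℚ ∈ 𝕍^non_ℚ`, or the radial log-volume, when `v_ℚ ∈ 𝕍^arc_ℚ`, on each of the direct
summand `p_{v_ℚ}`-adic fields … one obtains … log-volumes … which are compatible with the log-volumes obtained
in (i), relative to the natural poly-isomorphisms of Proposition 3.2, (i). In particular, these log-volumes may
be constructed via a functorial algorithm from the `𝒟^⊢`-prime-strips under consideration … a similar theory … for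
… "`𝓘_{†𝓕^{⊢×μ}_v}`" … compatible with the theory obtained for "`𝒟^⊢`" relative to the various natural
poly-isomorphisms"; Proposition 3.2 (i), p. 98: "functoriality of ⊗" (the poly-isomorphisms of tensor packets induced
FACTOR BY FACTOR by poly-isomorphisms of log-shells); [IUTchIV] Prop. 1.5 (iii) p. 15–16 (archimedean: the
decomposition of `M_I` and `B_I` "are preserved by the automorphisms of `M_I` induced by the various primitive
automorphisms").

WHAT THIS FILE ADDS (over part II `PacketLogVolumesHaarModelCapsulesGeneral.lean`: `capsulePacketLogVolume F A q` =
`μ^log_{A,v_ℚ}` on GENUINE regions; over abc-iut-w5-d178's `tensorLogVolume_image_factor` / `haar_image_factor`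
(p415006: `μ^log_{⊗k}` is transported along factorwise ISOMETRIC field isomorphisms — Prop. 3.9 (ii) at one tensor
packet) and abc-iut-L5-t7's `packetLogVol_image_induced` / `volume_image_image_eq_of_preservesDecomposition` (the
archimedean packet log-volume is invariant under the automorphisms induced by isometries of the factors)):
* `PortionIsm q π` — the "indeterminacies" of one portion: at `p` a family of ISOMETRIC `ℚ_p`-algebra automorphisms
  `φ_α` of the factors `F_{v_α}` (acting by `⊗_α φ_α`, campaign-S `factorAlgEquiv`); at `∞` a family of real linear
  isometries of the factors `ℂ` (acting by L5-t7's `induced`); `PortionIsm.apply`;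
* **`logVol_image_portionIsm : μ^log_π((⊗φ)(T)) = μ^log_π(T)`** for EVERY subset, and admissibility is preserved
  (`isAdm_image_portionIsm`);
* `ismRegion` / **`capsulePacketLogVolume_ismRegion : μ^log_{A,v_ℚ}(φ·T) = μ^log_{A,v_ℚ}(T)`** for every family
  `φ = (φ_π)_π` of portion isometries, globally `ismGlobalRegion` / **`globalLogVolume_ismGlobalRegion`**;
* BY NAME: the `A`-packet at `v_ℚ` as ONE carrier `CapsulePacketCarrier F A q = Σ_π X_π` (the disjoint union of its
  portions, i.e. `log(^A𝓕_{v_ℚ}) = ⊕_π ⊗_α K_{v_α}` as a set) with the set-level log-volume `capsuleSetLogVolume`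
  (`Σ_π portionWeight(π)·μ^log_π(S ∩ X_π)`), the induced self-bijections `CapsulePacketCarrier.ismEquiv φ`, and
  **`prop39ii_monoAnalyticCompat_capsulePacket` : abc-iut-L6-t4's `Prop39ii_monoAnalyticCompat` HOLDS** for the
  poly-isomorphism `{ismEquiv φ | φ ∈ P}` (any set `P` of families of portion isometries) with the genuine
  `μ^log_{A,v_ℚ}` on both sides — Prop. 3.9 (ii) for capsules at the genuine model (the `|A| = 1`, place-by-place
  Haar-model discharge is abc-iut-L6-d3's `prop39ii_monoAnalyticCompat_localField` / `_arch`, p411342/p411711; the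
  one-tensor-packet version is w5-d178's `prop39ii_monoAnalyticCompat_tensorPacket`, p415006).

HONEST SCOPE. As parts I–II (`K = F_mod = F`, `⊗_ℝ` of copies of `ℂ` at `∞`, all positive-finite-volume regions);
the poly-isomorphisms here are the FACTORWISE isometric ones (the shape of Prop. 3.2 (i)'s "functoriality of ⊗");
the identification of print's `𝒟^⊢`-side carriers with these packets is the strip-level junction R-ii-strip of
plan/L6/SUBDAG-IUTchIII-Prop-39.md (L6-t3's `StripFrame` carriers), not typed here. Classical (Haar / Lebesgue
transport); nothing here bears on [IUTchIII] Cor. 3.12 or takes a side; typed ≠ endorsed.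
[cite: Mochizuki2012, IUTchIV Prop. 1.5 (iii) p. 15]
-/

noncomputable section

namespace Literature.IUT.LogThetaLattice

open Literature.IUT.LogVolume Literature.IUT.LogVolume.Prop15iii NumberField IsDedekindDomain MeasureTheory Set
open scoped ENNReal NNReal

variable (F : Type) [Field F] [NumberField F]
variable (A : Type) [Fintype A] [DecidableEq A] [Nonempty A]

/-! ### Factorwise isometric automorphisms of a portion -/

/-- **The isometric factorwise automorphisms of the portion `π`** ("the natural poly-isomorphisms of Proposition
3.2, (i)" are induced factor by factor): at `∞`, a real linear isometry of each factor `ℂ` (the primitive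
automorphisms of [IUTchIV] Prop. 1.5 (iii) and their composites); at `p`, an ISOMETRIC `ℚ_p`-algebra automorphism of
each factor `F_{v_α}`. [claim: Mochizuki2012, status: disputed] -/
def PortionIsm : (q : RatPlace) → Portion F A q → Type
  | Sum.inl (), _ => A → Unit → (ℂ ≃ₗᵢ[ℝ] ℂ)
  | Sum.inr p, π =>
      haveI : Fact (p : ℕ).Prime := ⟨p.2⟩
      {φ : ∀ α, Kp F p (packetPrimeEquiv F p (π α)) ≃ₐ[ℚ_[p]] Kp F p (packetPrimeEquiv F p (π α)) //
        ∀ α (x : Kp F p (packetPrimeEquiv F p (π α))), ‖φ α x‖ = ‖x‖}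

/-- The induced automorphism `⊗_α φ_α` of the portion carrier (L5-t7's `induced` at `∞`, campaign-S's
`factorAlgEquiv` at `p`). [claim: Mochizuki2012, status: disputed] -/
def PortionIsm.apply :
    (q : RatPlace) → (π : Portion F A q) → PortionIsm F A q π → (portionDatum F A q π).X → (portionDatum F A q π).X
  | Sum.inl (), _, τ => fun x => induced A Unit τ x
  | Sum.inr p, π, φ => fun x =>
      haveI : Fact (p : ℕ).Prime := ⟨p.2⟩
      factorAlgEquiv p (fun β => Kp F p (packetPrimeEquiv F p (π β)))
        (fun β => Kp F p (packetPrimeEquiv F p (π β))) φ.1 x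

/-- **Admissibility is preserved** (the Haar / Lebesgue volume of the image is the volume: w5-d178's
`haar_image_factor`, L5-t7's `volume_image_image_eq_of_preservesDecomposition`). [claim: Mochizuki2012, status: disputed] -/
theorem isAdm_image_portionIsm (q : RatPlace) (π : Portion F A q) (φ : PortionIsm F A q π)
    {T : Set (portionDatum F A q π).X} (hT : (portionDatum F A q π).IsAdm T) :
    (portionDatum F A q π).IsAdm (PortionIsm.apply F A q π φ '' T) := by
  rcases q with ⟨⟩ | p
  · haveI : Nonempty Unit := ⟨()⟩
    change volume ((canonicalDecomposition A Unit : MI A Unit → (Idx A Unit → ℂ)) ''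
        ((fun x => induced A Unit φ x) '' T)) ≠ 0 ∧
      volume ((canonicalDecomposition A Unit : MI A Unit → (Idx A Unit → ℂ)) ''
        ((fun x => induced A Unit φ x) '' T)) ≠ ∞
    rw [show (fun x => induced A Unit φ x) '' T = induced A Unit φ '' T from rfl,
      volume_image_image_eq_of_preservesDecomposition (canonicalDecomposition A Unit)
        (preservesDecomposition_induced (canonicalDecomposition A Unit) φ) T]
    exact hT
  · haveI : Fact (p : ℕ).Prime := ⟨p.2⟩
    change 0 < (integerStructure p (fun β => Kp F p (packetPrimeEquiv F p (π β)))).haar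
        ((fun x => factorAlgEquiv p (fun β => Kp F p (packetPrimeEquiv F p (π β)))
          (fun β => Kp F p (packetPrimeEquiv F p (π β))) φ.1 x) '' T) ∧
      (integerStructure p (fun β => Kp F p (packetPrimeEquiv F p (π β)))).haar
        ((fun x => factorAlgEquiv p (fun β => Kp F p (packetPrimeEquiv F p (π β)))
          (fun β => Kp F p (packetPrimeEquiv F p (π β))) φ.1 x) '' T) < ∞
    rw [show (fun x => factorAlgEquiv p (fun β => Kp F p (packetPrimeEquiv F p (π β)))
          (fun β => Kp F p (packetPrimeEquiv F p (π β))) φ.1 x) '' T =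
        factorAlgEquiv p (fun β => Kp F p (packetPrimeEquiv F p (π β)))
          (fun β => Kp F p (packetPrimeEquiv F p (π β))) φ.1 '' T from rfl,
      haar_image_factor p _ _ φ.1 φ.2]
    exact hT

/-- **The portion log-volume is invariant**: `μ^log_π((⊗φ)(T)) = μ^log_π(T)` for EVERY subset `T` (w5-d178's
`tensorLogVolume_image_factor`; L5-t7's `packetLogVol_image_induced`). [claim: Mochizuki2012, status: disputed] -/
theorem logVol_image_portionIsm (q : RatPlace) (π : Portion F A q) (φ : PortionIsm F A q π)
    (T : Set (portionDatum F A q π).X) :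
    (portionDatum F A q π).logVol (PortionIsm.apply F A q π φ '' T) = (portionDatum F A q π).logVol T := by
  rcases q with ⟨⟩ | p
  · change packetLogVol (canonicalDecomposition A Unit) ((fun x => induced A Unit φ x) '' T) =
      packetLogVol (canonicalDecomposition A Unit) T
    exact packetLogVol_image_induced (canonicalDecomposition A Unit) φ T
  · haveI : Fact (p : ℕ).Prime := ⟨p.2⟩
    change tensorLogVolume p (fun β => Kp F p (packetPrimeEquiv F p (π β)))
        ((fun x => factorAlgEquiv p (fun β => Kp F p (packetPrimeEquiv F p (π β)))
          (fun β => Kp F p (packetPrimeEquiv F p (π β))) φ.1 x) '' T) =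
      tensorLogVolume p (fun β => Kp F p (packetPrimeEquiv F p (π β))) T
    exact tensorLogVolume_image_factor p _ _ φ.1 φ.2 T

/-! ### The `A`-packet log-volume is invariant -/

/-- The image of a region of the `A`-packet under a family `φ = (φ_π)_π` of portion isometries.
[claim: Mochizuki2012, status: disputed] -/
def ismRegion (q : RatPlace) (φ : ∀ π : Portion F A q, PortionIsm F A q π)
    (T : ∀ π : Portion F A q, (portionDatum F A q π).Adm) : ∀ π : Portion F A q, (portionDatum F A q π).Adm :=
  fun π => ⟨PortionIsm.apply F A q π (φ π) '' (T π).1, isAdm_image_portionIsm F A q π (φ π) (T π).2⟩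

/-- **[IUTchIII] Prop. 3.9 (ii) at the genuine `A`-packet**: `μ^log_{A,v_ℚ}(φ·T) = μ^log_{A,v_ℚ}(T)` for every family of
factorwise isometric automorphisms of the portions — the log-volume "may be constructed via a functorial algorithm"
from data defined only up to these isomorphisms. [claim: Mochizuki2012, status: disputed] -/
theorem capsulePacketLogVolume_ismRegion (q : RatPlace) (φ : ∀ π : Portion F A q, PortionIsm F A q π)
    (T : ∀ π : Portion F A q, (portionDatum F A q π).Adm) :
    capsulePacketLogVolume F A q (ismRegion F A q φ T) = capsulePacketLogVolume F A q T := by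
  unfold capsulePacketLogVolume
  exact Finset.sum_congr rfl fun π _ =>
    congrArg (fun r => portionWeight F A q π * r) (logVol_image_portionIsm F A q π (φ π) (T π).1)

/-- The image of a GLOBAL region under portion isometries at every `v_ℚ` (still a global region).
[claim: Mochizuki2012, status: disputed] -/
def ismGlobalRegion (φ : ∀ (q : RatPlace) (π : Portion F A q), PortionIsm F A q π)
    (S : GlobalRegion (capsulePacketLogVolume F A)) : GlobalRegion (capsulePacketLogVolume F A) :=
  ⟨fun q => ismRegion F A q (φ q) (S.1 q), by
    refine S.2.subset fun q hq => ?_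
    rw [Function.mem_support, capsulePacketLogVolume_ismRegion] at hq
    exact Function.mem_support.mpr hq⟩

/-- **`μ^log_{A,𝕍_ℚ}(φ·S) = μ^log_{A,𝕍_ℚ}(S)`**: the global log-volume is invariant under portion isometries at every `v_ℚ`.
[claim: Mochizuki2012, status: disputed] -/
theorem globalLogVolume_ismGlobalRegion (φ : ∀ (q : RatPlace) (π : Portion F A q), PortionIsm F A q π)
    (S : GlobalRegion (capsulePacketLogVolume F A)) :
    globalLogVolume (capsulePacketLogVolume F A) (ismGlobalRegion F A φ S) =
      globalLogVolume (capsulePacketLogVolume F A) S := by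
  unfold globalLogVolume
  exact finsum_congr fun q => capsulePacketLogVolume_ismRegion F A q (φ q) (S.1 q)

/-! ### BY NAME: `Prop39ii_monoAnalyticCompat` for the `A`-packet as one carrier -/

/-- **The `A`-packet at `v_ℚ` as ONE carrier**: the disjoint union of its portions, `log(^A𝓕_{v_ℚ}) = ⊕_π ⊗_α K_{v_α}`
as a set. [claim: Mochizuki2012, status: disputed] -/
def CapsulePacketCarrier (q : RatPlace) : Type := Σ π : Portion F A q, (portionDatum F A q π).X

/-- **The set-level `A`-packet log-volume** on subsets of the carrier: `Σ_π portionWeight(π)·μ^log_π(S ∩ X_π)` — on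
a direct-product region `∐_π T_π` this is `capsulePacketLogVolume` (`capsuleSetLogVolume_sigma`).
[claim: Mochizuki2012, status: disputed] -/
def capsuleSetLogVolume (q : RatPlace) (S : Set (CapsulePacketCarrier F A q)) : ℝ :=
  ∑ π : Portion F A q, portionWeight F A q π * (portionDatum F A q π).logVol {x | (⟨π, x⟩ : CapsulePacketCarrier F A q) ∈ S}

/-- On the region `∐_π T_π` the set-level log-volume is `μ^log_{A,v_ℚ}(T)`. [claim: Mochizuki2012, status: disputed] -/
theorem capsuleSetLogVolume_sigma (q : RatPlace) (T : ∀ π : Portion F A q, (portionDatum F A q π).Adm) :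
    capsuleSetLogVolume F A q {x | x.2 ∈ (T x.1).1} = capsulePacketLogVolume F A q T := rfl

/-- The self-bijection of the `A`-packet carrier induced by a family of portion isometries (fibrewise `⊗_α φ_α`).
[claim: Mochizuki2012, status: disputed] -/
def CapsulePacketCarrier.ismEquiv (q : RatPlace) (φ : ∀ π : Portion F A q, PortionIsm F A q π) :
    CapsulePacketCarrier F A q ≃ CapsulePacketCarrier F A q := by
  refine Equiv.sigmaCongrRight fun π => ?_
  rcases q with ⟨⟩ | p
  · exact (LinearEquiv.ofBijective (induced A Unit (φ π))
      ⟨LinearMap.injective_iff_surjective.mpr (induced_surjective A Unit (φ π)), induced_surjective A Unit (φ π)⟩).toEquiv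
  · haveI : Fact (p : ℕ).Prime := ⟨p.2⟩
    exact (factorAlgEquiv p (fun β => Kp F p (packetPrimeEquiv F p (π β)))
      (fun β => Kp F p (packetPrimeEquiv F p (π β))) (φ π).1).toEquiv

/-- The fibre map of `ismEquiv` is `PortionIsm.apply`. [claim: Mochizuki2012, status: disputed] -/
theorem CapsulePacketCarrier.ismEquiv_apply (q : RatPlace) (φ : ∀ π : Portion F A q, PortionIsm F A q π)
    (π : Portion F A q) (x : (portionDatum F A q π).X) :
    CapsulePacketCarrier.ismEquiv F A q φ ⟨π, x⟩ = ⟨π, PortionIsm.apply F A q π (φ π) x⟩ := by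
  rcases q with ⟨⟩ | p
  · rfl
  · rfl

/-- The fibres of the image under `ismEquiv` are the images of the fibres. [claim: Mochizuki2012, status: disputed] -/
theorem CapsulePacketCarrier.fibre_image_ismEquiv (q : RatPlace) (φ : ∀ π : Portion F A q, PortionIsm F A q π)
    (S : Set (CapsulePacketCarrier F A q)) (π : Portion F A q) :
    {x | (⟨π, x⟩ : CapsulePacketCarrier F A q) ∈ CapsulePacketCarrier.ismEquiv F A q φ '' S} =
      PortionIsm.apply F A q π (φ π) '' {x | (⟨π, x⟩ : CapsulePacketCarrier F A q) ∈ S} := by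
  ext y
  simp only [Set.mem_setOf_eq, Set.mem_image]
  constructor
  · rintro ⟨⟨π', x⟩, hx, h⟩
    rw [CapsulePacketCarrier.ismEquiv_apply] at h
    obtain ⟨rfl, h2⟩ := Sigma.mk.inj_iff.mp h
    exact ⟨x, hx, eq_of_heq h2⟩
  · rintro ⟨x, hx, rfl⟩
    exact ⟨⟨π, x⟩, hx, CapsulePacketCarrier.ismEquiv_apply F A q φ π x⟩

/-- **IUTchIII:Prop3.9(ii)** (kurims p. 116) BY NAME AT THE GENUINE `A`-PACKET: for any set `P` of families of
factorwise isometric automorphisms of the portions (the shape of "the natural poly-isomorphisms of Proposition 3.2,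
(i)", induced factor by factor), abc-iut-L6-t4's `Prop39ii_monoAnalyticCompat` HOLDS for the induced poly-isomorphism
`{ismEquiv φ | φ ∈ P}` of the `A`-packet carrier with the genuine `μ^log_{A,v_ℚ}` on both sides — "compatible with the
log-volumes obtained in (i), relative to the natural poly-isomorphisms". [claim: Mochizuki2012, status: disputed] -/
theorem prop39ii_monoAnalyticCompat_capsulePacket (q : RatPlace)
    (P : Set (∀ π : Portion F A q, PortionIsm F A q π)) :
    Prop39ii_monoAnalyticCompat ((fun φ => CapsulePacketCarrier.ismEquiv F A q φ) '' P)
      (capsuleSetLogVolume F A q) (capsuleSetLogVolume F A q) := by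
  rintro _ ⟨φ, _, rfl⟩ S
  unfold capsuleSetLogVolume
  refine Finset.sum_congr rfl fun π _ => ?_
  rw [CapsulePacketCarrier.fibre_image_ismEquiv, logVol_image_portionIsm]

end Literature.IUT.LogThetaLattice

end
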